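import Literature.NumberTheory.EllipticCurves.DivisionTowerH1OrderTwoFrames
import HarnessLib

/-!
# `#H¹(Gal(L/K), E(L)[2^k]) ≤ 2` for surjective `ρ̄_{E,2^k}` — PART 2: the special elements
# (`V = E[2]`, transvections, homothety `3`, swap) in a frame of `E[2^k]`

`Proofs`-style file (THEOREMS ONLY).  Discharges the hypotheses of the abstract criterion
`Rubin1987.eq_zero_or_eq_zero_or_eq_of_mem_subgroupResKer` (`DivisionTowerH1OrderTwoCriterion`) for an
elliptic curve `E/K` over ANY field with `2 ≠ 0` and SURJECTIVE mod-`2^k` representation (`k ≥ 1`), in a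
frame `e : E[2^k] ≃ (ℤ/2^k)²` with framed representation `ρ : Γ_K → GL₂(ℤ/2^k)`
(`DivisionTowerH1OrderTwoFrames`): `V = E[2] = {0, E₁, E₂, E₁ + E₂}` with `E₁ = e⁻¹(2^{k-1}, 0)`,
`E₂ = e⁻¹(0, 2^{k-1})`; `z = ρ⁻¹(3)`, the transvections `t = ρ⁻¹(1 1; 0 1)`, `t' = ρ⁻¹(1 0; 1 1)`, the
swap `s`; the diagonal family = all `σ` with `ρ(σ)` diagonal, normalised by `t, t'` up to powers of
`t², t'²` (`T D = D T^{2m+1}`); and the `LDU` generation of the stabiliser of `V` (the matrices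
`≡ 1 mod 2`).  Main theorems:

* `LawsonWuthrich2016.eq_zero_or_eq_zero_or_eq_of_mem_subgroupResKer_two_pow` — any two non-zero
  classes of `ker (H¹(Γ_K, E[2^k]) → H¹(N, E[2^k]))` coincide, for every open normal `N ⊇ Γ_{K(E[2^k])}`;
* `LawsonWuthrich2016.natCard_subgroupResKer_two_pow_le_two` — **`#H¹(Gal(L/K), E(L)[2^k]) ≤ 2`** for
  every finite Galois `L ⊆ K(E[2^k])` (`N = Gal(K̄/L)`), in particular `#H¹(K(E[2^k])/K, E[2^k]) ≤ 2`.

Together with `DivisionTowerH1AnnihilatorOfHomothetyProofs` (`2 · H¹ = 0`) this is the `p = 2`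
replacement of the vanishing `H¹(K(E[p^k])/K, E[p^k]) = 0` (`p` odd, one homothety `≠ 1`) used by the
Kolyvagin-system arguments; consumers: route `GenusKolyvaginAtTwo` (cruxes 22136/22137, the `(H2′)`
repair of LINE 6).  «beyond-print theorem»: no (finite group cohomology of `GL₂(ℤ/2^k)`;
Lawson–Wuthrich 2016 §7.1).  BSD is NOT proved by this file.

References: T. Lawson, C. Wuthrich, *Vanishing of some Galois cohomology groups for elliptic curves*
(2016), §2, Lemma 3, §7.1 [LawsonWuthrich2016]; C.-H. Sah, J. Algebra 10 (1968), Prop. 2.7 (b) [Sah1968].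
-/

set_option autoImplicit false

noncomputable section

open scoped Classical MatrixGroups

open WeierstrassCurve Field Matrix Literature.NumberTheory.GaloisRepresentations

universe u

namespace Literature.NumberTheory.EllipticCurves

namespace LawsonWuthrich2016

section Discharge

variable {K : Type u} [Field K] (W : WeierstrassCurve K) (j : ℕ)
  (e : geomTorsion W ((2 ^ (j + 1) : ℕ) : ℤ) ≃+ (Fin 2 → ZMod (2 ^ (j + 1))))
  (ρ : absoluteGaloisGroup K →* GL (Fin 2) (ZMod (2 ^ (j + 1))))
  (hρ : ∀ (σ : absoluteGaloisGroup K) (P : geomTorsion W ((2 ^ (j + 1) : ℕ) : ℤ)),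
    e (σ • P) = ((ρ σ : GL (Fin 2) (ZMod (2 ^ (j + 1)))) : Matrix (Fin 2) (Fin 2) (ZMod (2 ^ (j + 1)))) *ᵥ e P)


/-! ##### The four-element group `V = E[2]` in the frame -/

include hρ in
/-- Action in coordinates: `σ • e⁻¹ v = e⁻¹ (ρ(σ) v)`. [cite: LawsonWuthrich2016, §2 (G_i ≤ GL₂(ℤ/p^i), reduction mod p)] -/
theorem smul_symm (σ : absoluteGaloisGroup K) (v : Fin 2 → (ZMod (2 ^ (j + 1)))) :
    σ • e.symm v = e.symm (((ρ σ : GL (Fin 2) (ZMod (2 ^ (j + 1)))) : Matrix (Fin 2) (Fin 2) (ZMod (2 ^ (j + 1)))) *ᵥ v) := by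
  rw [smul_eq_symm_mulVec W e ρ hρ, e.apply_symm_apply]

omit hρ in
/-- `2 • e⁻¹ v = e⁻¹ (2 v)`. [cite: LawsonWuthrich2016, §2 (G_i ≤ GL₂(ℤ/p^i), reduction mod p)] -/
theorem two_zsmul_symm (v : Fin 2 → (ZMod (2 ^ (j + 1)))) :
    (2 : ℤ) • e.symm v = e.symm (fun i ↦ 2 * v i) := by
  rw [← map_zsmul]
  congr 1
  funext i
  simp [zsmul_eq_mul]

/-- The elements of `V = E[2]` in coordinates: `2 v = 0` iff each coordinate is `0` or `2^j`. [cite: LawsonWuthrich2016, §2 (G_i ≤ GL₂(ℤ/p^i), reduction mod p)] -/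
theorem two_zsmul_eq_zero_iff (P : geomTorsion W ((2 ^ (j + 1) : ℕ) : ℤ)) :
    (2 : ℤ) • P = 0 ↔ ∀ i, 2 * e P i = 0 := by
  constructor
  · intro h i
    have h' := congr_arg e h
    rw [map_zsmul, map_zero] at h'
    have := congr_fun h' i
    simpa [zsmul_eq_mul] using this
  · intro h
    apply e.injective
    rw [map_zsmul, map_zero]
    funext i
    simpa [zsmul_eq_mul] using h i

/-- `V = {0, E₁, E₂, E₁ + E₂}` with `E₁ = e⁻¹(2^j, 0)`, `E₂ = e⁻¹(0, 2^j)`. [cite: LawsonWuthrich2016, §2 (G_i ≤ GL₂(ℤ/p^i), reduction mod p)] -/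
theorem mem_V_iff (P : geomTorsion W ((2 ^ (j + 1) : ℕ) : ℤ)) (hP : (2 : ℤ) • P = 0) :
    P = 0 ∨ P = e.symm ![((2 : ZMod (2 ^ (j + 1))) ^ j), 0] ∨ P = e.symm ![0, ((2 : ZMod (2 ^ (j + 1))) ^ j)] ∨ P = e.symm ![((2 : ZMod (2 ^ (j + 1))) ^ j), 0] + e.symm ![0, ((2 : ZMod (2 ^ (j + 1))) ^ j)] := by
  have h := (two_zsmul_eq_zero_iff W j e P).1 hP
  have h0 := eq_zero_or_eq_half_of_two_mul_eq_zero j _ (h 0)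
  have h1 := eq_zero_or_eq_half_of_two_mul_eq_zero j _ (h 1)
  have hv : e P = ![e P 0, e P 1] := by ext i; fin_cases i <;> rfl
  have key : ∀ v : Fin 2 → (ZMod (2 ^ (j + 1))), e P = v → P = e.symm v := fun v hv ↦ by
    rw [← hv, e.symm_apply_apply]
  rcases h0 with h0 | h0 <;> rcases h1 with h1 | h1
  · left
    have : P = e.symm ![0, 0] := key _ (by rw [hv, h0, h1])
    rw [this, ← e.symm.map_zero]
    congr 1; ext i; fin_cases i <;> rfl
  · right; right; left
    exact key _ (by rw [hv, h0, h1])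
  · right; left
    exact key _ (by rw [hv, h0, h1])
  · right; right; right
    rw [← map_add]
    refine key _ ?_
    rw [hv, h0, h1]
    ext i; fin_cases i <;> simp

omit hρ in
/-- `2 E₁ = 0` in the frame. [cite: LawsonWuthrich2016, §2 (G_i ≤ GL₂(ℤ/p^i), reduction mod p)] -/
theorem two_zsmul_E₁ : (2 : ℤ) • e.symm ![((2 : ZMod (2 ^ (j + 1))) ^ j), 0] = 0 := by
  rw [two_zsmul_symm, ← e.symm.map_zero]
  congr 1; funext i; fin_cases i
  · simpa using two_mul_half_eq_zero j
  · simp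

omit hρ in
/-- `2 E₂ = 0` in the frame. [cite: LawsonWuthrich2016, §2 (G_i ≤ GL₂(ℤ/p^i), reduction mod p)] -/
theorem two_zsmul_E₂ : (2 : ℤ) • e.symm ![0, ((2 : ZMod (2 ^ (j + 1))) ^ j)] = 0 := by
  rw [two_zsmul_symm, ← e.symm.map_zero]
  congr 1; funext i; fin_cases i
  · simp
  · simpa using two_mul_half_eq_zero j

omit hρ in
/-- `E₁ ≠ 0`. [cite: LawsonWuthrich2016, §2 (G_i ≤ GL₂(ℤ/p^i), reduction mod p)] -/
theorem E₁_ne_zero : e.symm ![((2 : ZMod (2 ^ (j + 1))) ^ j), 0] ≠ 0 := by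
  intro h
  have h' := congr_fun (congr_arg e h) 0
  simp only [e.apply_symm_apply, map_zero, Matrix.cons_val_zero, Pi.zero_apply] at h'
  exact half_ne_zero j h'

omit hρ in
/-- `E₂ ≠ 0`. [cite: LawsonWuthrich2016, §2 (G_i ≤ GL₂(ℤ/p^i), reduction mod p)] -/
theorem E₂_ne_zero : e.symm ![0, ((2 : ZMod (2 ^ (j + 1))) ^ j)] ≠ 0 := by
  intro h
  have h' := congr_fun (congr_arg e h) 1
  simp only [e.apply_symm_apply, map_zero, Matrix.cons_val_one, Matrix.cons_val_fin_one,
    Pi.zero_apply] at h'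
  exact half_ne_zero j h'

omit hρ in
/-- `E₁ ≠ E₂`. [cite: LawsonWuthrich2016, §2 (G_i ≤ GL₂(ℤ/p^i), reduction mod p)] -/
theorem E₁_ne_E₂ : e.symm ![((2 : ZMod (2 ^ (j + 1))) ^ j), 0] ≠ e.symm ![0, ((2 : ZMod (2 ^ (j + 1))) ^ j)] := by
  intro h
  have h' := congr_fun (e.symm.injective h) 0
  simp only [Matrix.cons_val_zero] at h'
  exact half_ne_zero j h'

/-! ##### Matrix bookkeeping -/

omit hρ in
/-- `(a b; c d) (x, y) = (ax + by, cx + dy)`. [cite: LawsonWuthrich2016, §2 (G_i ≤ GL₂(ℤ/p^i), reduction mod p)] -/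
theorem mulVec_two (a b c d x y : (ZMod (2 ^ (j + 1)))) :
    (!![a, b; c, d] : Matrix (Fin 2) (Fin 2) (ZMod (2 ^ (j + 1)))) *ᵥ ![x, y] = ![a * x + b * y, c * x + d * y] := by
  funext i; fin_cases i <;> simp [Matrix.mulVec, dotProduct, Fin.sum_univ_two]

include hρ in
/-- Action of an element with known matrix on `e⁻¹ v`. [cite: LawsonWuthrich2016, §2 (G_i ≤ GL₂(ℤ/p^i), reduction mod p)] -/
theorem smul_symm_of_rep_eq {σ : absoluteGaloisGroup K} {A : Matrix (Fin 2) (Fin 2) (ZMod (2 ^ (j + 1)))}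
    (hA : ((ρ σ : GL (Fin 2) (ZMod (2 ^ (j + 1)))) : Matrix (Fin 2) (Fin 2) (ZMod (2 ^ (j + 1)))) = A) (v : Fin 2 → (ZMod (2 ^ (j + 1)))) :
    σ • e.symm v = e.symm (A *ᵥ v) := by
  rw [smul_symm W j e ρ hρ, hA]

omit hρ in
/-- `e⁻¹ v + e⁻¹ w = e⁻¹ (v + w)`. [cite: LawsonWuthrich2016, §2 (G_i ≤ GL₂(ℤ/p^i), reduction mod p)] -/
theorem symm_add (v w : Fin 2 → (ZMod (2 ^ (j + 1)))) : e.symm v + e.symm w = e.symm (v + w) := (map_add _ _ _).symm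

omit hρ in
/-- Coordinatewise addition of `2`-vectors. [cite: LawsonWuthrich2016, §2 (G_i ≤ GL₂(ℤ/p^i), reduction mod p)] -/
theorem vec_add (a b c d : (ZMod (2 ^ (j + 1)))) : (![a, b] : Fin 2 → (ZMod (2 ^ (j + 1)))) + ![c, d] = ![a + c, b + d] := by
  funext i; fin_cases i <;> simp

/-! ##### The transvections `t = ρ⁻¹(1 1; 0 1)`, `t' = ρ⁻¹(1 0; 1 1)` -/

include hρ in
/-- `t E₁ = E₁` for `ρ(t) = (1 1; 0 1)`. [cite: LawsonWuthrich2016, §2 (G_i ≤ GL₂(ℤ/p^i), reduction mod p)] -/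
theorem t_smul_E₁ {t : absoluteGaloisGroup K}
    (ht : ((ρ t : GL (Fin 2) (ZMod (2 ^ (j + 1)))) : Matrix (Fin 2) (Fin 2) (ZMod (2 ^ (j + 1)))) = !![1, 1; 0, 1]) :
    t • e.symm ![((2 : ZMod (2 ^ (j + 1))) ^ j), 0] = e.symm ![((2 : ZMod (2 ^ (j + 1))) ^ j), 0] := by
  rw [smul_symm_of_rep_eq W j e ρ hρ ht, mulVec_two]; simp

include hρ in
/-- `t E₂ = E₁ + E₂` for `ρ(t) = (1 1; 0 1)`. [cite: LawsonWuthrich2016, §2 (G_i ≤ GL₂(ℤ/p^i), reduction mod p)] -/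
theorem t_smul_E₂ {t : absoluteGaloisGroup K}
    (ht : ((ρ t : GL (Fin 2) (ZMod (2 ^ (j + 1)))) : Matrix (Fin 2) (Fin 2) (ZMod (2 ^ (j + 1)))) = !![1, 1; 0, 1]) :
    t • e.symm ![0, ((2 : ZMod (2 ^ (j + 1))) ^ j)] = e.symm ![((2 : ZMod (2 ^ (j + 1))) ^ j), 0] + e.symm ![0, ((2 : ZMod (2 ^ (j + 1))) ^ j)] := by
  rw [smul_symm_of_rep_eq W j e ρ hρ ht, mulVec_two, symm_add, vec_add]; simp

include hρ in
/-- `t' E₁ = E₁ + E₂` for `ρ(t') = (1 0; 1 1)`. [cite: LawsonWuthrich2016, §2 (G_i ≤ GL₂(ℤ/p^i), reduction mod p)] -/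
theorem t'_smul_E₁ {t' : absoluteGaloisGroup K}
    (ht' : ((ρ t' : GL (Fin 2) (ZMod (2 ^ (j + 1)))) : Matrix (Fin 2) (Fin 2) (ZMod (2 ^ (j + 1)))) = !![1, 0; 1, 1]) :
    t' • e.symm ![((2 : ZMod (2 ^ (j + 1))) ^ j), 0] = e.symm ![((2 : ZMod (2 ^ (j + 1))) ^ j), 0] + e.symm ![0, ((2 : ZMod (2 ^ (j + 1))) ^ j)] := by
  rw [smul_symm_of_rep_eq W j e ρ hρ ht', mulVec_two, symm_add, vec_add]; simp

include hρ in
/-- `t' E₂ = E₂` for `ρ(t') = (1 0; 1 1)`. [cite: LawsonWuthrich2016, §2 (G_i ≤ GL₂(ℤ/p^i), reduction mod p)] -/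
theorem t'_smul_E₂ {t' : absoluteGaloisGroup K}
    (ht' : ((ρ t' : GL (Fin 2) (ZMod (2 ^ (j + 1)))) : Matrix (Fin 2) (Fin 2) (ZMod (2 ^ (j + 1)))) = !![1, 0; 1, 1]) :
    t' • e.symm ![0, ((2 : ZMod (2 ^ (j + 1))) ^ j)] = e.symm ![0, ((2 : ZMod (2 ^ (j + 1))) ^ j)] := by
  rw [smul_symm_of_rep_eq W j e ρ hρ ht', mulVec_two]; simp

include hρ in
/-- **Halving**: `t x − x ∈ 2M` and `t' x − x ∈ 2M` force `x ∈ 2M` (coordinates: `x₁` and `x₀` are even).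
[cite: LawsonWuthrich2016, §2] -/
theorem halving {t t' : absoluteGaloisGroup K}
    (ht : ((ρ t : GL (Fin 2) (ZMod (2 ^ (j + 1)))) : Matrix (Fin 2) (Fin 2) (ZMod (2 ^ (j + 1)))) = !![1, 1; 0, 1])
    (ht' : ((ρ t' : GL (Fin 2) (ZMod (2 ^ (j + 1)))) : Matrix (Fin 2) (Fin 2) (ZMod (2 ^ (j + 1)))) = !![1, 0; 1, 1])
    (x : geomTorsion W ((2 ^ (j + 1) : ℕ) : ℤ))
    (h1 : ∃ y : geomTorsion W ((2 ^ (j + 1) : ℕ) : ℤ), t • x - x = (2 : ℤ) • y)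
    (h2 : ∃ y : geomTorsion W ((2 ^ (j + 1) : ℕ) : ℤ), t' • x - x = (2 : ℤ) • y) :
    ∃ w : geomTorsion W ((2 ^ (j + 1) : ℕ) : ℤ), x = (2 : ℤ) • w := by
  obtain ⟨y, hy⟩ := h1
  obtain ⟨y', hy'⟩ := h2
  have hx : x = e.symm ![e x 0, e x 1] :=
    e.eq_symm_apply.mpr (by ext i; fin_cases i <;> rfl)
  -- coordinate `1` is even
  have c1 : e x 1 = 2 * e y 0 := by
    have h := congr_arg e hy
    rw [map_sub, map_zsmul, hx, smul_symm_of_rep_eq W j e ρ hρ ht, e.apply_symm_apply,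
      e.apply_symm_apply, mulVec_two] at h
    simpa [zsmul_eq_mul] using congr_fun h 0
  -- coordinate `0` is even
  have c0 : e x 0 = 2 * e y' 1 := by
    have h := congr_arg e hy'
    rw [map_sub, map_zsmul, hx, smul_symm_of_rep_eq W j e ρ hρ ht', e.apply_symm_apply,
      e.apply_symm_apply, mulVec_two] at h
    simpa [zsmul_eq_mul] using congr_fun h 1
  refine ⟨e.symm ![e y' 1, e y 0], ?_⟩
  rw [two_zsmul_symm, hx, c0, c1]
  congr 1; funext i; fin_cases i <;> simp

/-! ##### The homothety `z = ρ⁻¹(3)` -/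

include hρ in
/-- An element with `ρ(z) = 3` acts as the homothety `3`. [cite: LawsonWuthrich2016, §2 (G_i ≤ GL₂(ℤ/p^i), reduction mod p)] -/
theorem z_smul {z : absoluteGaloisGroup K}
    (hz : ((ρ z : GL (Fin 2) (ZMod (2 ^ (j + 1)))) : Matrix (Fin 2) (Fin 2) (ZMod (2 ^ (j + 1)))) = !![3, 0; 0, 3])
    (x : geomTorsion W ((2 ^ (j + 1) : ℕ) : ℤ)) : z • x = (3 : ℤ) • x := by
  have hx : x = e.symm ![e x 0, e x 1] :=
    e.eq_symm_apply.mpr (by ext i; fin_cases i <;> rfl)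
  rw [hx, smul_symm_of_rep_eq W j e ρ hρ hz, mulVec_two, ← map_zsmul]
  congr 1; funext i; fin_cases i <;> simp [zsmul_eq_mul]

include hρ in
/-- An element with `ρ(z) = 3` is central modulo `Γ_{K(E[2^k])}`. [cite: LawsonWuthrich2016, §2 (G_i ≤ GL₂(ℤ/p^i), reduction mod p)] -/
theorem z_central {z : absoluteGaloisGroup K}
    (hz : ((ρ z : GL (Fin 2) (ZMod (2 ^ (j + 1)))) : Matrix (Fin 2) (Fin 2) (ZMod (2 ^ (j + 1)))) = !![3, 0; 0, 3])
    (g : absoluteGaloisGroup K) :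
    ∃ n ∈ torsionFixing W ((2 ^ (j + 1) : ℕ) : ℤ), z * g = g * z * n := by
  refine exists_mem_torsionFixing_of_rep_eq W e ρ hρ (Units.ext ?_)
  rw [map_mul, map_mul, Units.val_mul, Units.val_mul, hz]
  have h3 : (!![3, 0; 0, 3] : Matrix (Fin 2) (Fin 2) (ZMod (2 ^ (j + 1)))) = (3 : (ZMod (2 ^ (j + 1)))) • (1 : Matrix (Fin 2) (Fin 2) (ZMod (2 ^ (j + 1)))) := by
    ext i j; fin_cases i <;> fin_cases j <;> simp
  rw [h3, Matrix.smul_mul, Matrix.mul_smul, Matrix.one_mul, Matrix.mul_one]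

/-! ##### The swap: `s t s⁻¹ ≡ t' (mod Γ_{K(E[2^k])})` -/

include hρ in
/-- **`s t s⁻¹ ≡ t' (mod Γ_{K(E[2^k])})`** for `ρ(s)` the swap and `ρ(t), ρ(t')` the transvections
(`S T S⁻¹ = T'`). [cite: LawsonWuthrich2016, §2 (G_i ≤ GL₂(ℤ/p^i), reduction mod p)] -/
theorem swap_conj {s t t' : absoluteGaloisGroup K}
    (hs : ((ρ s : GL (Fin 2) (ZMod (2 ^ (j + 1)))) : Matrix (Fin 2) (Fin 2) (ZMod (2 ^ (j + 1)))) = !![0, 1; 1, 0])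
    (ht : ((ρ t : GL (Fin 2) (ZMod (2 ^ (j + 1)))) : Matrix (Fin 2) (Fin 2) (ZMod (2 ^ (j + 1)))) = !![1, 1; 0, 1])
    (ht' : ((ρ t' : GL (Fin 2) (ZMod (2 ^ (j + 1)))) : Matrix (Fin 2) (Fin 2) (ZMod (2 ^ (j + 1)))) = !![1, 0; 1, 1]) :
    ∃ n ∈ torsionFixing W ((2 ^ (j + 1) : ℕ) : ℤ), s * t * s⁻¹ = t' * n := by
  refine exists_mem_torsionFixing_of_rep_eq W e ρ hρ ?_
  rw [map_mul, map_mul, map_inv, mul_inv_eq_iff_eq_mul]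
  apply Units.ext
  rw [Units.val_mul, Units.val_mul, hs, ht, ht']
  exact swap_mul_transvection

end Discharge

end LawsonWuthrich2016

end Literature.NumberTheory.EllipticCurves

end
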